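import Summits.ABC.IUTFork.Repair.RHHullCellSlackSum
import Summits.ABC.IUTFork.Repair.RHHullCellSliceHeightScaling
import Mathlib.Analysis.SpecialFunctions.Pow.Real
import Mathlib.Analysis.SpecialFunctions.Pow.Asymptotics
import HarnessLib

/-!
# R-H ROUND 3, AXIS D2 (HEIGHT SCALING) — SHARED VOCABULARY of the two typers (DOOR / BARRIER): object classes, recovered-fraction
# profiles under the height dilation `m_q ↦ s·m_q`, exponents, «door»; and the PRICE CEILING of the typed cell (every class certifies
# at most the conductor-type price ⇒ exponent `≤ −1`; no door inside the ceiling; the near-miss is across-place netting)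

abc-iut cell, rung LADDER-ABC:A2.RESCUE.H; seat abc-iut-rh2-T-1 (gen 6), KEY `wake/KEY-abc-iut-rh2-T-1-D2-TYPE-DOOR.md` (priority8 2026-08-27
T12:14:07Z on 21-frontier 11:38:40Z / 11:44:07Z AXIS D2: per object class (slice · SRM · within-place financing · partial credit · across-place
netting · κ′ laws) the recovered-fraction EXPONENT in the height, then BARRIER «every combination of classes X has exponent < 0 ⇒ cannot close
Cor 3.12 at height ≥ h₀» or DOOR «a combination with exponent ≥ 0 and its constant on the bed»; this seat = TYPER 2 of 2 (DOOR + the shared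
vocabulary), sibling abc-iut-rh2-w-2 = BARRIER). Input of record `plan/rescue/R-H/ROUND3/D0121-FINAL-1200Z.md` c9ab8e0bbc43dc94 (1)(d)/(e):
«the credit is conductor-type while T grows with height (C/R ∝ h⁻¹)»; height scaling = `m_q ↦ s·m_q` at fixed places and `l` (fitted exponent
of C/R: FREY133 −0.9994 · HEX79 −1.0001 · FREY482 −0.9991; netted-Statement crossing `s× = Π/M` median 1.8226 / 3.8306 / 1.9972).

WHAT IS TYPED (namespace `Summit.ABC.IUTFork.Repair.RH.HeightScaling`; plain `def`/`inductive`, no instance, no notation):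
* §1 VOCABULARY (reals). A RECOVERED-FRACTION PROFILE is `f : ℝ → ℝ`, a function of the dilation factor `s ≥ 1` (certified mass / total
  trivial mass `M(s) = s·M(1)`: every cell's trivial cost `(j²−1)·m_q·(log p)/e` is linear in `m_q`). `ExponentAtMost f α C` :⟺ `∀ s ≥ 1,
  f s ≤ C·s^α`; `NegExponent f`; `DoorAt f` :⟺ `∃ c > 0, ∀ s ≥ 1, c ≤ f s` («exponent ≥ 0 with a positive constant»); `EventuallyBelow f θ`;
  `ObjectClass` (the six classes + the hypothesis class `licenceCut` of R18); `IsCombination Φ X f` (finite sums of profiles of classes in `X`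
  under an admissibility table `Φ : ObjectClass → Set (ℝ → ℝ)`); `Door Φ X`. Mechanism: `eventuallyBelow_of_exponentAtMost` (α < 0 ⇒ below
  every positive threshold from some height on; the BARRIER typer composes it with MIN-SLICE (ii) `RH.SigmaMass.massThreshold_le_onTrivialMass_iff`),
  `not_doorAt_of_negExponent`, `NegExponent.add`, `not_door_of_forall_negExponent`.
* §2 PRICE CEILING of the typed cell (integers; the conjugate-fibre cell `RH.DiffPricedHull.HullCellδ e m j δ r_in r_out` of the R-W WINDOW-TABLE;
  rh2-w-2 `RHHullCellSlice` ledger form `demand_j = (j²−1)·m ≤ price_j = j·δ + (j+1)(r_in−r_out) + ρ_j`): `price`, `demand`, and the m-FREE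
  `priceCap := (δ + 2(r_in−r_out) + (e−1))·j` (q2-hull `price_le_linear`). Per cell, EVERY depth `m ≥ 0` (every dilation `m = s·m₁`): LICENCE/
  SLICE `demand ≤ priceCap` on a licensed cell; SRM / PARTIAL CREDIT `min demand price ≤ priceCap`; FINANCING / NETTING surplus `price − demand
  ≤ priceCap`. Place totals over labels `1…L`: `2·Σ price ≤ (δ+2G+e−1)·L(L+1)` against `6·Σ demand = m·L(L−1)(2L+5)`.
* §3 EXPONENTS. `exponentAtMost_neg_one_of_le_const` (certificate ≤ s-free `Π̄` over total `s·M₁` ⇒ exponent −1, constant `Π̄/M₁`);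
  `not_door_of_priceBounded`: **NO DOOR among combinations of classes whose certificates obey the price ceiling** (all six at conjugate fibres).
  SLICE COLLAPSE (abc-iut-rh2-q2-hull `RHHullCellSliceHeightScaling` BY NAME: slice `= {1}` once `3m > 2δ + 3G + (e−1)`): the slice then
  certifies `demand m 1 = 0` (`demand_eq_zero_of_hullCellδ_of_lt`) — a finite-height zero.
* §4 NEAR-MISS OF RECORD = ACROSS-PLACE NETTING: the netted place inequality `Σ_j (demand_j − price_j) ≤ 0` FAILS once `m·L(L−1)(2L+5) >
  3(δ+2G+e−1)·L(L+1)` and HOLDS while `m·L(L−1)(2L+5) ≤ 3[(δ+G)L(L+1) + 2G·L]`: exponent −1, per-place crossing `≈ 3(δ+2G+e)/(2·m₁·L)`; bed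
  constants (FINAL (1)(e), datum level): `s× = Π/M` median 1.8226 FREY133 (min 1.2998) · 3.8306 HEX79 · 1.9972 FREY482.
* §5 THE TWO EXPONENT-0 PROFILES. (a) `licenceCut` (R18): a licence HYPOTHESIS on `j ≤ ⌈κ·l⋆⌉` certifies `s`-proportional demands, profile
  ≡ `μ₀(κ) = W(⌈κl⋆⌉)/W(l⋆)` ⇒ `DoorAt` — a hypothesis, not a bed object (on the beds the licensed set is the slice, which collapses). (b)
  MIXED-FIBRE HEIGHT TRANSFER (this seat's p493746 §3): `(m_q(v_b′)/e − j²·min_a m_q(v_a)/e)⁺` dilates EXACTLY like `s` (`transfer_dilate`):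
  exponent 0, `doorAt_transfer_iff : DoorAt ↔ 0 < τ`; `τ = 0` whenever per-unit local heights agree across the fibre — every conjugate fibre,
  i.e. every fibre of FREY133 / HEX79 / FREY482 and of every datum with `F_mod = ℚ` (bed constant 0).
DOOR VERDICT AS TYPED HERE (numbers quoted from the FINAL, not re-derived): no door inside the typed currency at conjugate fibres; strongest
near-miss = across-place netting (exponent −1, bed constant `Π/M`); exponent-0 profiles = a licence hypothesis (constant `μ₀(κ)`) and the
mixed-fibre transfer (bed constant 0). HONEST FRAMING: kernel facts about OUR typed cell and real bookkeeping; class exponents / bed constants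
are the D2-EXP seats' and the assembler's deliverables, QUOTED here; nothing here asserts that abc is proved or refuted, or that [IUTchIII]
Cor. 3.12 holds or fails at any datum, or takes a side on any author; typed ≠ proved; computed ≠ proved. [claim: Mochizuki2012, status:
disputed] for every IUT locution. [cite: Mochizuki2012, IUTchIII Cor. 3.12 p. 173; IUTchIV Prop. 1.2 p. 10, Thm. 1.10 p. 21]
-/

namespace Summit.ABC.IUTFork.Repair.RH.HeightScaling

open Finset Filter Topology
open Summit.ABC.IUTFork.Repair.RH.DiffPricedHull Summit.ABC.IUTFork.Repair.RH.HullCellSlice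
open Summit.ABC.IUTFork.Repair.RH.HullCellSlackSum

/-! ## §1. Vocabulary: profiles, exponents, doors, classes, combinations -/

/-- `ExponentAtMost f α C`: the recovered-fraction profile `f` (a function of the height-dilation factor `s`, `m_q ↦ s·m_q` at fixed places
and `l`) satisfies `f s ≤ C·s^α` for every `s ≥ 1` — «exponent (at most) `α` in the height with constant `C`». [folklore] -/
@[folklore]
def ExponentAtMost (f : ℝ → ℝ) (α C : ℝ) : Prop :=
  ∀ s : ℝ, 1 ≤ s → f s ≤ C * s ^ α

/-- `NegExponent f`: `f` has SOME negative exponent with a non-negative constant. [folklore] -/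
@[folklore]
def NegExponent (f : ℝ → ℝ) : Prop :=
  ∃ α C : ℝ, α < 0 ∧ 0 ≤ C ∧ ExponentAtMost f α C

/-- `DoorAt f`: the profile stays above a POSITIVE constant at every height — «exponent ≥ 0 with constant `c > 0`». [folklore] -/
@[folklore]
def DoorAt (f : ℝ → ℝ) : Prop :=
  ∃ c : ℝ, 0 < c ∧ ∀ s : ℝ, 1 ≤ s → c ≤ f s

/-- `EventuallyBelow f θ`: from some height on the profile is below `θ`. [folklore] -/
@[folklore]
def EventuallyBelow (f : ℝ → ℝ) (θ : ℝ) : Prop :=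
  ∃ s₀ : ℝ, 1 ≤ s₀ ∧ ∀ s : ℝ, s₀ ≤ s → f s < θ

/-- The OBJECT CLASSES of the round-3 library (21-frontier AXIS D 2026-08-27T11:38:40Z, in that order) plus the hypothesis class
`licenceCut` (MIN-SLICE §(v-R18): licence on the labels `j ≤ ⌈κ·l⋆⌉` at every bad place). Class words ↔ FINAL rungs: `slice` = r0 (μ₄),
`srm`/`partialCredit` = r1 (exact-slack ceiling μ_ex, socket L1), `withinPlaceFinancing` = r2 (EX/within, FIN-REACH), `acrossPlaceNetting` =
r3 (EX/across, print's reading), `kappaLaw` = the axis-B/C `κ′ ≠ 2` weight laws. [folklore] -/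
@[folklore]
inductive ObjectClass : Type
  | slice
  | srm
  | withinPlaceFinancing
  | partialCredit
  | acrossPlaceNetting
  | kappaLaw
  | licenceCut

/-- `IsCombination Φ X f`: under the admissibility table `Φ` (class ↦ the set of recovered-fraction profiles the typed currency admits for
objects of that class) the profile `f` is a finite SUM of profiles of objects whose classes lie in `X`. [folklore] -/
@[folklore]
inductive IsCombination (Φ : ObjectClass → Set (ℝ → ℝ)) (X : Set ObjectClass) : (ℝ → ℝ) → Prop
  | single {κ : ObjectClass} {f : ℝ → ℝ} (hκ : κ ∈ X) (hf : f ∈ Φ κ) : IsCombination Φ X f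
  | add {f g : ℝ → ℝ} (hf : IsCombination Φ X f) (hg : IsCombination Φ X g) : IsCombination Φ X (f + g)

/-- `Door Φ X`: SOME combination of objects of classes in `X` is a door (stays above a positive constant at every height). [folklore] -/
@[folklore]
def Door (Φ : ObjectClass → Set (ℝ → ℝ)) (X : Set ObjectClass) : Prop :=
  ∃ f : ℝ → ℝ, IsCombination Φ X f ∧ DoorAt f

/-- A profile bounded by an `s`-free constant has exponent `0`. [folklore] -/
theorem exponentAtMost_zero_of_le {f : ℝ → ℝ} {C : ℝ} (h : ∀ s : ℝ, 1 ≤ s → f s ≤ C) : ExponentAtMost f 0 C := by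
  intro s hs
  rw [Real.rpow_zero, mul_one]
  exact h s hs

/-- A profile bounded by `C/s` has exponent `−1`. [folklore] -/
theorem exponentAtMost_neg_one_of_le_div {f : ℝ → ℝ} {C : ℝ} (h : ∀ s : ℝ, 1 ≤ s → f s ≤ C / s) : ExponentAtMost f (-1) C := by
  intro s hs
  rw [Real.rpow_neg_one, ← div_eq_mul_inv]
  exact h s hs

/-- Exponents only get WORSE upward: `α ≤ β`, `C ≥ 0` ⇒ `ExponentAtMost f α C → ExponentAtMost f β C` (`s ≥ 1`). [folklore] -/
theorem ExponentAtMost.mono {f : ℝ → ℝ} {α β C : ℝ} (h : ExponentAtMost f α C) (hαβ : α ≤ β) (hC : 0 ≤ C) :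
    ExponentAtMost f β C := fun s hs =>
  (h s hs).trans (mul_le_mul_of_nonneg_left (Real.rpow_le_rpow_of_exponent_le hs hαβ) hC)

/-- Sums: `ExponentAtMost f α C`, `ExponentAtMost g α D` ⇒ `ExponentAtMost (f + g) α (C + D)`. [folklore] -/
theorem ExponentAtMost.add {f g : ℝ → ℝ} {α C D : ℝ} (hf : ExponentAtMost f α C) (hg : ExponentAtMost g α D) :
    ExponentAtMost (f + g) α (C + D) := fun s hs => by
  rw [Pi.add_apply, add_mul]
  exact add_le_add (hf s hs) (hg s hs)

/-- **Negative exponents are closed under finite sums** (take the larger exponent and add the constants). [folklore] -/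
theorem NegExponent.add {f g : ℝ → ℝ} (hf : NegExponent f) (hg : NegExponent g) : NegExponent (f + g) := by
  obtain ⟨α, C, hα, hC, hf⟩ := hf
  obtain ⟨β, D, hβ, hD, hg⟩ := hg
  refine ⟨max α β, C + D, max_lt hα hβ, add_nonneg hC hD, ?_⟩
  exact (hf.mono (le_max_left _ _) hC).add (hg.mono (le_max_right _ _) hD)

/-- **THE BARRIER MECHANISM (real half).** A profile with a NEGATIVE exponent falls below EVERY positive threshold `θ` from some height on.
(`s^α = s^{−(−α)} → 0` as `s → ∞`, `tendsto_rpow_neg_atTop`.) The BARRIER typer composes this with MIN-SLICE (ii): closing Cor. 3.12 at the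
datum in the σ-mass currency needs recovered fraction `≥ T/M = 1 − Tol/M` (`RH.SigmaMass.massThreshold_le_onTrivialMass_iff`). [folklore] -/
theorem eventuallyBelow_of_exponentAtMost {f : ℝ → ℝ} {α C θ : ℝ} (h : ExponentAtMost f α C) (hα : α < 0) (hθ : 0 < θ) :
    EventuallyBelow f θ := by
  have ht : Tendsto (fun s : ℝ => C * s ^ α) atTop (𝓝 (C * 0)) := by
    have h0 := (tendsto_rpow_neg_atTop (show 0 < -α by linarith)).const_mul C
    simpa only [neg_neg] using h0
  rw [mul_zero] at ht
  obtain ⟨N, hN⟩ := Filter.eventually_atTop.mp (ht.eventually (gt_mem_nhds hθ))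
  refine ⟨max 1 N, le_max_left _ _, fun s hs => ?_⟩
  exact (h s ((le_max_left _ _).trans hs)).trans_lt (hN s ((le_max_right _ _).trans hs))

/-- `EventuallyBelow f c` for the door constant `c` contradicts `DoorAt`. [folklore] -/
theorem not_doorAt_of_forall_eventuallyBelow {f : ℝ → ℝ} (h : ∀ θ : ℝ, 0 < θ → EventuallyBelow f θ) : ¬ DoorAt f := by
  rintro ⟨c, hc, hf⟩
  obtain ⟨s₀, hs₀, hlt⟩ := h c hc
  exact absurd (hf s₀ hs₀) (not_le.mpr (hlt s₀ le_rfl))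

/-- **A negative exponent is never a door.** [folklore] -/
theorem not_doorAt_of_negExponent {f : ℝ → ℝ} (h : NegExponent f) : ¬ DoorAt f := by
  obtain ⟨α, C, hα, -, h⟩ := h
  exact not_doorAt_of_forall_eventuallyBelow fun θ hθ => eventuallyBelow_of_exponentAtMost h hα hθ

/-- Every combination of classes all of whose admissible profiles have negative exponents has a negative exponent. [folklore] -/
theorem negExponent_of_isCombination {Φ : ObjectClass → Set (ℝ → ℝ)} {X : Set ObjectClass}
    (hΦ : ∀ κ ∈ X, ∀ f ∈ Φ κ, NegExponent f) {f : ℝ → ℝ} (hf : IsCombination Φ X f) : NegExponent f := by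
  induction hf with
  | single hκ hg => exact hΦ _ hκ _ hg
  | add _ _ ihf ihg => exact ihf.add ihg

/-- **«exponent < 0 for every class in `X` ⇒ NO DOOR among combinations of classes in `X`»** — the abstract half of the BARRIER/DOOR
dichotomy (the Cor. 3.12 half is the BARRIER typer's, abc-iut-rh2-w-2). [folklore] -/
theorem not_door_of_forall_negExponent {Φ : ObjectClass → Set (ℝ → ℝ)} {X : Set ObjectClass}
    (hΦ : ∀ κ ∈ X, ∀ f ∈ Φ κ, NegExponent f) : ¬ Door Φ X := by
  rintro ⟨f, hf, hd⟩
  exact not_doorAt_of_negExponent (negExponent_of_isCombination hΦ hf) hd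

/-- A profile pinned below by a positive `s`-free constant IS a door (used for the two exponent-0 terms of §5). [folklore] -/
theorem doorAt_of_const_le {f : ℝ → ℝ} {c : ℝ} (hc : 0 < c) (h : ∀ s : ℝ, 1 ≤ s → c ≤ f s) : DoorAt f :=
  ⟨c, hc, h⟩

/-! ## §2. The PRICE CEILING of the typed cell (integers; conjugate-fibre / diagonal cell of the R-W WINDOW-TABLE) -/

/-- The PRICE of the cell at label `j` and depth `m` (= `m_q`, the HEIGHT-type parameter): `j·δ + (j+1)·(r_in − r_out) + ρ_j`,
`ρ_j = (j²m − jδ − (j+1)r_in) mod e` — rh2-w-2's ledger form of `HullCellδ` (`RHHullCellSlice.hullCellδ_iff_demand_le_price`). [folklore] -/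
@[folklore]
def price (e m j δ rin rout : ℤ) : ℤ :=
  j * δ + (j + 1) * (rin - rout) + (j ^ 2 * m - j * δ - (j + 1) * rin) % e

/-- The DEMAND (trivial cost in `(log p)/e` units) of the cell at label `j`, depth `m`: `(j²−1)·m` — LINEAR in the height parameter. [folklore] -/
@[folklore]
def demand (m j : ℤ) : ℤ :=
  (j ^ 2 - 1) * m

/-- The CONDUCTOR-TYPE PRICE CAP `(δ + 2(r_in − r_out) + (e−1))·j`: different exponent `δ`, log-shell span `G = r_in − r_out`, ramification
`e`, label `j` — and NO depth `m` (q2-hull `RHHullCellSlackSum.price_le_linear`). [folklore] -/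
@[folklore]
def priceCap (e δ rin rout j : ℤ) : ℤ :=
  (δ + 2 * (rin - rout) + (e - 1)) * j

/-- Ledger form in this file's words: `HullCellδ ⟺ demand ≤ price`. [folklore] -/
theorem hullCellδ_iff_demand_le_price' (e m j δ rin rout : ℤ) :
    HullCellδ e m j δ rin rout ↔ demand m j ≤ price e m j δ rin rout :=
  hullCellδ_iff_demand_le_price e m j δ rin rout

/-- **The price is conductor-type**: `price ≤ priceCap` at every label `j ≥ 1`, for EVERY depth `m` (`0 < e`, `r_out ≤ r_in`). [folklore] -/
theorem price_le_priceCap {e m j δ rin rout : ℤ} (he : 0 < e) (hio : rout ≤ rin) (hj : 1 ≤ j) :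
    price e m j δ rin rout ≤ priceCap e δ rin rout j :=
  price_le_linear he hio hj

/-- The demand is non-negative at `j ≥ 1`, `m ≥ 0`, and vanishes at the label `j = 1`. [folklore] -/
theorem demand_nonneg {m j : ℤ} (hm : 0 ≤ m) (hj : 1 ≤ j) : 0 ≤ demand m j :=
  mul_nonneg (by nlinarith) hm

/-- The label-`1` cell is weightless: `demand m 1 = 0`. [folklore] -/
theorem demand_one (m : ℤ) : demand m 1 = 0 := by unfold demand; ring

/-- The demand is LINEAR in the depth: `demand (s·m₁) j = s·demand m₁ j` (height dilation). [folklore] -/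
theorem demand_dilate (s m₁ j : ℤ) : demand (s * m₁) j = s * demand m₁ j := by unfold demand; ring

/-- **CLASS LAW 1 (slice / licence): a LICENSED cell certifies its demand, and that demand is below the conductor-type cap** —
`HullCellδ ⟹ demand ≤ priceCap`, every depth. [folklore] -/
theorem demand_le_priceCap_of_hullCellδ {e m j δ rin rout : ℤ} (he : 0 < e) (hio : rout ≤ rin) (hj : 1 ≤ j)
    (h : HullCellδ e m j δ rin rout) : demand m j ≤ priceCap e δ rin rout j :=
  ((hullCellδ_iff_demand_le_price' e m j δ rin rout).mp h).trans (price_le_priceCap he hio hj)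

/-- **CLASS LAW 2 (SRM / partial credit): the COVERED SHARE `min(demand, price)` of a cell is below the cap**, every depth. [folklore] -/
theorem covered_le_priceCap {e m j δ rin rout : ℤ} (he : 0 < e) (hio : rout ≤ rin) (hj : 1 ≤ j) :
    min (demand m j) (price e m j δ rin rout) ≤ priceCap e δ rin rout j :=
  (min_le_right _ _).trans (price_le_priceCap he hio hj)

/-- **CLASS LAW 3 (within-place financing / across-place netting move SURPLUSES): `price − demand ≤ priceCap`**, every depth `m ≥ 0`. [folklore] -/
theorem surplus_le_priceCap {e m j δ rin rout : ℤ} (he : 0 < e) (hio : rout ≤ rin) (hj : 1 ≤ j) (hm : 0 ≤ m) :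
    price e m j δ rin rout - demand m j ≤ priceCap e δ rin rout j := by
  have h1 := price_le_priceCap (m := m) (δ := δ) he hio hj
  have h2 := demand_nonneg hm hj
  linarith

/-- **PLACE TOTAL OF PRICES IS m-FREE**: `2·Σ_{j=1}^{L} price_j ≤ (δ + 2(r_in−r_out) + (e−1))·L·(L+1)` (q2-hull `two_mul_sum_price_le` at `J = 0`).
[folklore] -/
theorem two_mul_sum_price_le_cap {e m δ rin rout : ℤ} (he : 0 < e) (hio : rout ≤ rin) (L : ℕ) :
    2 * ∑ k ∈ range L, price e m (1 + (k : ℤ)) δ rin rout ≤ (δ + 2 * (rin - rout) + (e - 1)) * ((L : ℤ) * (L + 1)) := by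
  have h := two_mul_sum_price_le (m := m) (δ := δ) he hio (le_refl (0 : ℤ)) L
  simp only [zero_add, mul_zero] at h
  unfold price
  convert h using 3

/-- **PLACE TOTAL OF DEMANDS IS m TIMES A CUBIC**: `6·Σ_{j=1}^{L} demand_j = m·L(L−1)(2L+5)` (q2-hull `six_mul_sum_demand_eq` at `J = 0`;
`= 6m·S(L)`, rh2-w-1's `S`). [folklore] -/
theorem six_mul_sum_demand_eq' (m : ℤ) (L : ℕ) :
    6 * ∑ k ∈ range L, demand m (1 + (k : ℤ)) = m * ((L : ℤ) * (L - 1) * (2 * L + 5)) := by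
  have h := six_mul_sum_demand_eq 0 m L
  simp only [zero_add, zero_sub, mul_zero, zero_mul, sub_zero] at h
  unfold demand
  convert h using 2

/-! ## §3. Exponents: price-bounded ⇒ exponent −1 ⇒ no door; the slice collapses at finite height -/

/-- **PRICE-BOUNDED ⇒ EXPONENT −1.** If a certificate is bounded by an `s`-free `Π̄` at every dilation `s ≥ 1` while the total trivial mass
is `s·M₁` (`M₁ > 0`), the recovered fraction `cert(s)/(s·M₁)` has `ExponentAtMost (−1) (Π̄/M₁)`. [folklore] -/
theorem exponentAtMost_neg_one_of_le_const {cert : ℝ → ℝ} {Pbar M₁ : ℝ} (hM : 0 < M₁) (h : ∀ s : ℝ, 1 ≤ s → cert s ≤ Pbar) :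
    ExponentAtMost (fun s => cert s / (s * M₁)) (-1) (Pbar / M₁) := by
  refine exponentAtMost_neg_one_of_le_div fun s hs => ?_
  have hs0 : 0 < s := by linarith
  rw [div_div, mul_comm M₁ s]
  exact div_le_div_of_nonneg_right (h s hs) (by positivity)

/-- `PriceBounded M₁ f`: the profile `f` is the recovered fraction of a certificate bounded by an `s`-free constant over the total `s·M₁`. [folklore] -/
@[folklore]
def PriceBounded (M₁ : ℝ) (f : ℝ → ℝ) : Prop :=
  ∃ cert : ℝ → ℝ, ∃ Pbar : ℝ, (∀ s : ℝ, 1 ≤ s → cert s ≤ Pbar) ∧ ∀ s : ℝ, 1 ≤ s → f s = cert s / (s * M₁)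

/-- **A price-bounded profile has a negative exponent (namely −1).** [folklore] -/
theorem negExponent_of_priceBounded {M₁ : ℝ} (hM : 0 < M₁) {f : ℝ → ℝ} (hf : PriceBounded M₁ f) : NegExponent f := by
  obtain ⟨cert, Pbar, hcert, hf⟩ := hf
  refine ⟨-1, max Pbar 0 / M₁, by norm_num, div_nonneg (le_max_right _ _) hM.le, fun s hs => ?_⟩
  rw [hf s hs]
  exact exponentAtMost_neg_one_of_le_const hM (fun s hs => (hcert s hs).trans (le_max_left _ _)) s hs

/-- **NO DOOR INSIDE THE PRICE CEILING.** If every class in `X` admits only price-bounded profiles (over one total `s·M₁`, `M₁ > 0`), no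
combination of classes in `X` is a door. With §2 (every library class certifies ≤ price ≤ priceCap per cell at conjugate fibres) this is the
typed-currency face of «recovered fraction → 0 in the L-window» (FINAL (1)(d)). [folklore] -/
theorem not_door_of_priceBounded {M₁ : ℝ} (hM : 0 < M₁) {Φ : ObjectClass → Set (ℝ → ℝ)} {X : Set ObjectClass}
    (hΦ : ∀ κ ∈ X, ∀ f ∈ Φ κ, PriceBounded M₁ f) : ¬ Door Φ X :=
  not_door_of_forall_negExponent fun κ hκ f hf => negExponent_of_priceBounded hM (hΦ κ hκ f hf)

/-- **SLICE COLLAPSE, certificate form** (over abc-iut-rh2-q2-hull's D2-EXP-1 file `RHHullCellSliceHeightScaling`, BY NAME: once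
`2δ + 3(r_in − r_out) + (e−1) < 3m` the slice is EXACTLY `{1}`, `hullCellδ_iff_eq_one_of_lt`; on licensed labels `(J−1)·m ≤ δ + G + (e−1)`,
`sub_one_mul_le_of_hullCellδ` — the kernel form of N19's `j₀ ≤ 1 + (δ+G+e)/m_q`): past the collapse depth every licensed label is `1` and its
demand is `0` (`demand_one`) — under `m = s·m₁`, from `s > (2δ + 3G + e − 1)/(3m₁)` on the slice class certifies NOTHING at the place. [folklore] -/
theorem demand_eq_zero_of_hullCellδ_of_lt {e m j δ rin rout : ℤ} (he : 0 < e) (hδ : e - 1 ≤ δ) (hio : rout ≤ rin) (hm : 0 ≤ m)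
    (h3 : 2 * δ + 3 * (rin - rout) + (e - 1) < 3 * m) (hj : 1 ≤ j) (h : HullCellδ e m j δ rin rout) : demand m j = 0 := by
  obtain rfl : j = 1 := (HullCellSliceHeightScaling.hullCellδ_iff_eq_one_of_lt he hδ hio hm h3 hj).mp h
  exact demand_one m

/-! ## §4. The near-miss of record: netting attains the price ceiling and crosses at `s× = Π/M` -/

/-- **NETTED PLACE INEQUALITY FAILS BEYOND THE CROSSING.** If `3(δ + 2(r_in−r_out) + (e−1))·L(L+1) < m·L(L−1)(2L+5)` then
`Σ_{j=1}^{L} (demand_j − price_j) > 0`: crediting EVERY cell's full price against the demands (netting across labels; across places the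
same sum weighted by `c_w ≥ 0`) cannot balance the books; with `m = s·m₁`: every `s > 3(δ+2G+e−1)(L+1)/(m₁(L−1)(2L+5))` — exponent `−1`,
the crossing of FINAL (1)(e) (`s× = Π/M` to leading order). [folklore] -/
theorem sum_demand_sub_price_pos_of_lt {e m δ rin rout : ℤ} (he : 0 < e) (hio : rout ≤ rin) (L : ℕ)
    (h : 3 * ((δ + 2 * (rin - rout) + (e - 1)) * ((L : ℤ) * (L + 1))) < m * ((L : ℤ) * (L - 1) * (2 * L + 5))) :
    0 < ∑ k ∈ range L, (demand m (1 + (k : ℤ)) - price e m (1 + (k : ℤ)) δ rin rout) := by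
  rw [sum_sub_distrib]
  have hp := two_mul_sum_price_le_cap (m := m) (δ := δ) he hio L
  have hd := six_mul_sum_demand_eq' m L
  linarith

/-- Conversely the netted place inequality HOLDS whenever the demands fit under the prices — in particular at every depth with
`m·L(L−1)(2L+5) ≤ 3·[(δ + (r_in−r_out))·L(L+1) + 2(r_in−r_out)·L]` (q2-hull `sum_price_ge` at `J = 0`): the tabulated-height side of the
crossing («ε = 0 on 216/216», FINAL (1)(d)). [folklore] -/
theorem sum_demand_sub_price_nonpos_of_le {e m δ rin rout : ℤ} (he : 0 < e) (L : ℕ)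
    (h : m * ((L : ℤ) * (L - 1) * (2 * L + 5)) ≤ 3 * ((δ + (rin - rout)) * ((L : ℤ) * (L + 1)) + 2 * (rin - rout) * L)) :
    ∑ k ∈ range L, (demand m (1 + (k : ℤ)) - price e m (1 + (k : ℤ)) δ rin rout) ≤ 0 := by
  rw [sum_sub_distrib]
  have hp := sum_price_ge (e := e) (m := m) (δ := δ) (rin := rin) (rout := rout) (J := 0) he L
  simp only [zero_add, mul_zero] at hp
  have hp' : (δ + (rin - rout)) * ((L : ℤ) * (L + 1)) + 2 * (rin - rout) * L ≤
      2 * ∑ k ∈ range L, price e m (1 + (k : ℤ)) δ rin rout := by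
    unfold price
    convert hp using 3
  have hd := six_mul_sum_demand_eq' m L
  linarith

/-! ## §5. The two exponent-0 terms -/

/-- **(a) `licenceCut` is a door BY HYPOTHESIS**: a licence hypothesis on a fixed label set certifies those cells' demands, which dilate
exactly like the total (`demand_dilate`), so the profile is the `s`-free constant `μ₀ = (Σ_{licensed} demand)/(Σ_{all} demand)`; a positive
constant profile is a `DoorAt`. (R18: `μ₀(κ) = W(⌈κl⋆⌉)/W(l⋆)`, e.g. `1/8` at `κ = 1/2`.) On the beds the licensed set is the slice, which
collapses (§3) — so this door is a HYPOTHESIS CLASS, not a bed-witnessed object. [folklore] -/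
theorem doorAt_const {μ₀ : ℝ} (hμ : 0 < μ₀) : DoorAt (fun _ => μ₀) :=
  doorAt_of_const_le hμ fun _ _ => le_rfl

/-- **(b) The MIXED-FIBRE HEIGHT TRANSFER dilates EXACTLY like `s`**: `(s·a − j²·(s·b))⁺ = s·(a − j²·b)⁺` for `s ≥ 0` (`a = m_q(v_b′)/e_{b′}`,
`b = min_a m_q(v_a)/e_a`; this seat's `RHCreditShellBudgetMixed` §3 transfer term). [folklore] -/
theorem transfer_dilate {s a b : ℝ} (j : ℝ) (hs : 0 ≤ s) :
    max (s * a - j ^ 2 * (s * b)) 0 = s * max (a - j ^ 2 * b) 0 := by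
  have : s * a - j ^ 2 * (s * b) = s * (a - j ^ 2 * b) := by ring
  rw [this]
  rcases le_or_gt 0 (a - j ^ 2 * b) with h | h
  · rw [max_eq_left h, max_eq_left (mul_nonneg hs h)]
  · rw [max_eq_right h.le, mul_zero, max_eq_right (by nlinarith)]

/-- **The transfer vanishes when the per-unit local heights satisfy `a ≤ j²·b`** — in particular whenever they AGREE across the fibre
(`a = b ≥ 0`, `j ≥ 1`): every conjugate fibre, i.e. every fibre of FREY133 / HEX79 / FREY482 and of every datum with `F_mod = ℚ`
(bed constant `0`). [folklore] -/
theorem transfer_eq_zero_of_le {a b : ℝ} (j : ℝ) (h : a ≤ j ^ 2 * b) : max (a - j ^ 2 * b) 0 = 0 :=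
  max_eq_right (by linarith)

/-- Equal per-unit heights, `b ≥ 0`, `j ≥ 1` ⇒ transfer `0`. [folklore] -/
theorem transfer_eq_zero_of_eq {b j : ℝ} (hb : 0 ≤ b) (hj : 1 ≤ j) : max (b - j ^ 2 * b) 0 = 0 :=
  transfer_eq_zero_of_le j (by nlinarith [mul_le_mul_of_nonneg_right (show (1 : ℝ) ≤ j ^ 2 by nlinarith) hb])

/-- **The transfer profile `s·τ/(s·M₁)` is a door iff `τ > 0`** (`M₁ > 0`): exponent `0` with constant `τ/M₁`; `τ = 0` on every conjugate
fibre. [folklore] -/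
theorem doorAt_transfer_iff {τ M₁ : ℝ} (hM : 0 < M₁) : DoorAt (fun s => s * τ / (s * M₁)) ↔ 0 < τ := by
  have key : ∀ s : ℝ, 1 ≤ s → s * τ / (s * M₁) = τ / M₁ := fun s hs => by
    rw [mul_div_mul_left _ _ (by linarith : s ≠ 0)]
  constructor
  · rintro ⟨c, hc, h⟩
    have h1 : c ≤ 1 * τ / (1 * M₁) := h 1 le_rfl
    rw [key 1 le_rfl] at h1
    exact (div_pos_iff_of_pos_right hM).mp (hc.trans_le h1)
  · intro hτ
    exact doorAt_of_const_le (div_pos hτ hM) fun s hs => (key s hs).symm.le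

/-! ## §6. Sanity rows (`decide` on R-W WINDOW-TABLE integers) -/

/-- HEX `λ₈ @ l = 11`, `p = 7` (`e = 165`, `m = 120`, `δ = 164`, `r_in = 28`, `r_out = −281`, `l⋆ = 5`): prices `847, 1323, 1874, 2335, 2706`
against demands `0, 360, 960, 1800, 2880` (q2-hull/rh2-tab-2 rows, margins `847, 963, 914, 535, −174`); cap slope `δ + 2G + e − 1 = 946`;
at the QUADRUPLED depth `m = 480` (dilation `s = 4`) label `2` is already off (`2δ + 3G + e − 1 = 1419 < 1440 = 3m`): collapse; at `s = 3`
(`3m = 1080 < 1419`) label `2` is still on. [folklore] -/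
theorem row_hex8_l11 :
    price 165 120 1 164 28 (-281) = 847 ∧ price 165 120 5 164 28 (-281) = 2706 ∧ demand 120 5 = 2880 ∧
      priceCap 165 164 28 (-281) 5 = 4730 ∧ (2 : ℤ) * 164 + 3 * (28 - (-281)) + (165 - 1) = 1419 ∧
        ¬ HullCellδ 165 480 2 164 28 (-281) ∧ HullCellδ 165 360 2 164 28 (-281) ∧ HullCellδ 165 120 2 164 28 (-281) := by
  unfold price demand priceCap HullCellδ
  decide

end Summit.ABC.IUTFork.Repair.RH.HeightScaling
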